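import Summits.ResolutionOfSingularities.ResolutionOfSingularities.Theorems.RadicialJungCleanModelsGiraudChartAtPoint
import Summits.ResolutionOfSingularities.ResolutionOfSingularities.Theorems.RadicialJungCleanModelsGiraudSingularFiniteOfCharts
import Summits.ResolutionOfSingularities.ResolutionOfSingularities.Theorems.RadicialJungCleanModelsChartRingData
import HarnessLib

/-!
# Route `RadicialJung`, crux `CleanModels` (stmt-15917): FINITENESS OF THE GIRAUD-SINGULAR POINTS —
# brick B3 of T2 (`HOME/L/res-L0-w81-pv-2/g5/T2-ARCHITECTURE.md`), assembled (S1f)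

Support file (OURS).  **Brick B3** (Giraud 1983, 1.6: "l'ensemble des points singuliers de `f`
est fini"): for `X` a regular integral quasi-compact scheme of dimension `2`, locally of finite
type over a field `k` of characteristic `p`, and `f ∈ Γ(X, 𝒪_X)` whose critical set `E(f)` is a
strict normal crossings divisor, the set of Giraud-singular points of `f` is finite
(`finite_isGiraudSingularPoint` — the T2 skeleton's `stub_finite_singular`, minus its unused
hypothesis that `f` is not a `p`-th power).

Assembly: every closed point has a Giraud chart (`exists_giraudChart_at`, S1e); the charts at the
closed points cover `X` (a quasi-compact `T₀` space: every point specialises to a closed point,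
`IsClosed.exists_closed_singleton`); a finite subcover feeds
`finite_setOf_isGiraudSingularPoint_of_charts` (FILE 5, res-L1-s42-pv-2), whose ring-theoretic
chart hypotheses are `chart_ring_data_of_isAffineOpen` (S1b, res-L0-w44-stub-4) and
`projective_kaehler_sections_of_isAffineOpen` (S1a, res-L1-type-o1).

References: J. Giraud, *Forme normale d'une fonction sur une surface de caractéristique positive*,
Bull. SMF 111 (1983), 1.6 and Lemme 2.6. [cite: Giraud1983]
-/

open CategoryTheory AlgebraicGeometry TopologicalSpace IsLocalRing Opposite
open Literature.AlgebraicGeometry.Resolution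

namespace Summit.ResolutionOfSingularities.ResolutionOfSingularities.Theorems.RadicialJung.CleanModels

/-- In a quasi-compact scheme every point lies in every open neighbourhood of some closed point
of its closure; hence opens chosen at the closed points cover the scheme. [folklore] -/
theorem exists_isClosed_singleton_forall_mem {X : Scheme.{0}} [CompactSpace X] (ξ : X) :
    ∃ ξ₁ : X, IsClosed ({ξ₁} : Set X) ∧ ∀ U : X.Opens, ξ₁ ∈ U → ξ ∈ U := by
  obtain ⟨ξ₁, hξ₁, hcl⟩ :=
    (isClosed_closure (s := ({ξ} : Set X))).exists_closed_singleton ⟨ξ, subset_closure rfl⟩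
  refine ⟨ξ₁, hcl, fun U hU => ?_⟩
  obtain ⟨z, hzU, hz⟩ := mem_closure_iff.mp hξ₁ U U.2 hU
  rw [Set.mem_singleton_iff] at hz
  exact hz ▸ hzU

/-- **Brick B3 — the Giraud-singular points are finite** (Giraud 1983, 1.6), for `X` regular,
integral, quasi-compact of dimension `2`, locally of finite type over a field of characteristic
`p`, and `E(f)` a strict normal crossings divisor. [cite: Giraud1983, 1.6] -/
theorem finite_isGiraudSingularPoint (p : ℕ) [Fact p.Prime] (k : Type) [Field k] [CharP k p]
    (X : Scheme.{0}) [IsIntegral X] [CompactSpace X] (q : X ⟶ Spec (.of k))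
    [LocallyOfFiniteType q] (hreg : Scheme.IsRegular X) (hdim : topologicalKrullDim X = 2)
    (f : Γ(X, ⊤)) (hsnc : IsStrictNormalCrossingsDivisor X (derivCriticalSet X f)) :
    {ξ : X | IsGiraudSingularPoint X f ξ}.Finite := by
  classical
  haveI : IsLocallyNoetherian X := LocallyOfFiniteType.isLocallyNoetherian q
  -- a chart at every closed point
  have hch := fun c : {ξ : X // IsClosed ({ξ} : Set X)} =>
    exists_giraudChart_at p k q hreg f hsnc c.2
  choose U hU hmem r x δ hδ hcrit using hch
  -- the charts cover `X`; extract a finite subcover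
  have hcov : (Set.univ : Set X) ⊆ ⋃ c, (U c : Set X) := by
    intro ξ _
    obtain ⟨ξ₁, hcl, hall⟩ := exists_isClosed_singleton_forall_mem ξ
    exact Set.mem_iUnion.mpr ⟨⟨ξ₁, hcl⟩, hall _ (hmem ⟨ξ₁, hcl⟩)⟩
  obtain ⟨t, ht⟩ := isCompact_univ.elim_finite_subcover (fun c => (U c : Set X))
    (fun c => (U c).2) hcov
  have hcover : ∀ ξ : X, ∃ i : t, ξ ∈ U i.1 := by
    intro ξ
    obtain ⟨c, hc⟩ := Set.mem_iUnion.mp (ht (Set.mem_univ ξ))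
    obtain ⟨hct, hξc⟩ := Set.mem_iUnion.mp hc
    exact ⟨⟨c, hct⟩, hξc⟩
  -- ring-theoretic data of the charts (S1b, S1a)
  have hne : ∀ c, ((U c : X.Opens) : Set X).Nonempty := fun c => ⟨c.1, hmem c⟩
  have hdata := fun c => chart_ring_data_of_isAffineOpen q (hU c) hreg hdim (hne c)
  exact finite_setOf_isGiraudSingularPoint_of_charts X f (fun i : t => U i.1) (fun i => hU i.1)
    hcover (fun i => (hdata i.1).1) (fun i => (hdata i.1).2.1) (fun i => (hdata i.1).2.2.1)
    (fun i => (hdata i.1).2.2.2)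
    (fun i => projective_kaehler_sections_of_isAffineOpen p k q hreg (hU i.1))
    (fun i => r i.1) (fun i => x i.1) (fun i => δ i.1) (fun i => hδ i.1) (fun i => hcrit i.1)

end Summit.ResolutionOfSingularities.ResolutionOfSingularities.Theorems.RadicialJung.CleanModels
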